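import Literature.AnabelianGeometry.SemiGraphs.TemperedAnabelianThm64SubProofs
import Literature.AnabelianGeometry.SemiGraphs.TemperedAnabelianTowerWitness
import Literature.AnabelianGeometry.SemiGraphs.TemperedProfiniteProducts
import Literature.AnabelianGeometry.SemiGraphs.DOFTypeHomComposition
import Mathlib.FieldTheory.Galois.Profinite
import Mathlib.GroupTheory.SpecificGroups.Alternating.Simple
import HarnessLib

/-!
# [SemiAnbd] Thm. 6.4 sub-DAG: T64-L07 `OuterDescent` fails at a TEMPERED datum — the André-tower
# input of `temperedAnabelianTheorem_of_tower` is necessary for the concluding inference too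

S. Mochizuki, *Semi-graphs of anabelioids*, Publ. RIMS **42** (2006) [SemiAnbd], Theorem 6.4, proof,
kurims p. 71 ll. 8–11 ("… by Lemma 6.3, (iii), we thus conclude that `φ` differs from `ψ` by composition
with an inner automorphism of `Π^temp_{Y_L}`"); Definition 3.1 (i) p. 33 (tempered groups).
[cite: MochizukiSemiAnbd2006, Thm 6.4 proof p.71]

PROOF-ONLY companion (no definition, no instance, no named fact) of `TemperedAnabelianThm64Sub.lean`
(abc-iut-w5-d139); sequel of `TemperedAnabelianThm64SubOuterDescentNegative.lean` (FROZEN FACT-LIST row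
**F-2838** `TemperedCurve.OuterDescent` = T64-L07; abc-iut F wave, tranche 171, seat abc-iut-f-171), whose
datum carries a SUBSPACE topology and is not tempered.  The necessity certificate
`TemperedAnabelianTowerNecessity` (abc-iut-w5-d240) has a TEMPERED datum `ℤ × G_{ℚ_p}` violating Lem. 6.1
(iii), Lem. 6.3 (iii), T64-L06′, Thm. 6.6 — but NOT T64-L07 (its extra profinite normaliser is central, so
outer descent holds there).  This file closes the gap:

* datum (inside `exists_temperedCurve_isTempered_not_outerDescent`; built for any finite simple group `S`
  with a non-central element, instantiated at `S := A₅ = alternatingGroup (Fin 5)`): `K := ℚ_p`,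
  `Π^temp := (⊕_ℕ S) × G_{ℚ_p}` with `⊕_ℕ S` (finitely supported sequences) DISCRETE — countable discrete
  groups are tempered (`isTempered_of_discreteTopology`), and so is the product with the profinite `G_{ℚ_p}`
  (`IsTempered.prod_of_profinite`); `Π := (∏_ℕ S) × G_{ℚ_p}`.  KEY LEMMA (`exists_finite_forall_mulSingle_mem`):
  `⊕_ℕ S ↪ ∏_ℕ S` IS the profinite completion of the discrete `⊕_ℕ S` — a normal subgroup of finite index
  `U` contains `e_i(S)` for all `i` off a finite set `F` (the trace of `U` on the `i`-th factor is normal in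
  the simple `S`; the indices of trivial trace inject into `(⊕_ℕ S)/U` by `i ↦ [e_i(a)]`, `a` non-central),
  so `U` is the preimage of the open normal `F`-cylinder over `U` in `∏_ℕ S`;
* `exists_temperedCurve_isTempered_not_outerDescent`: conjugation by a constant non-central sequence is a
  continuous onto endomorphism of `Π^temp`, `Π`-inner, not `Π^temp`-inner (a finitely supported conjugator
  is `1` somewhere): `IsTempered Y.PiTemp ∧ ¬ OuterDescent Y Y` (and `¬ Y.OpenDenseDOFConjugator`);
* `not_forall_isTempered_outerDescent`: `¬ ∀ X Y, IsTempered Y.PiTemp → OuterDescent X Y` — the binder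
  `htower₀` ([André] §4.5) of `TemperedCurve.temperedAnabelianTheorem_of_tower` cannot be weakened to
  `IsTempered` for the L07 step either; F-2838 is datum-guarded by necessity among tempered data.

HONEST FRAMING: a junk inhabitant of the INTERFACE; nothing of [SemiAnbd] is refuted or asserted (Thm. 6.4
concerns hyperbolic curves, whose `Π^temp` has the André tower).  Classical group theory only; no side is
taken on [IUTchIII] Cor. 3.12; typed ≠ proved.
-/

noncomputable section

namespace Literature.AnabelianGeometry.SemiGraphs

open _root_.Topology

/-! ### Finitely supported sequences in a product of copies of a finite simple group -/

section RestrictedProduct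

variable {S : Type} [Group S]

/-- Truncations converge: the finitely supported sequences are dense in `∏_ℕ S`. [folklore] -/
private theorem dense_setOf_mulSupport_finite [TopologicalSpace S] :
    Dense {f : ℕ → S | (Function.mulSupport f).Finite} := by
  intro f
  refine mem_closure_of_tendsto (f := fun n : ℕ => fun i => if i < n then f i else 1)
    (b := Filter.atTop) ?_ (Filter.Eventually.of_forall fun n => ?_)
  · rw [tendsto_pi_nhds]
    intro i
    refine (tendsto_const_nhds (x := f i)).congr' ?_
    filter_upwards [Filter.eventually_gt_atTop i] with n hn
    simp [hn]
  · refine (Set.finite_lt_nat n).subset fun i hi => by_contra fun h => hi ?_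
    exact if_neg (show ¬ i < n from h)

/-- A finitely supported sequence is `1` somewhere. [folklore] -/
private theorem exists_apply_eq_one_of_mulSupport_finite {f : ℕ → S}
    (hf : (Function.mulSupport f).Finite) : ∃ i, f i = 1 := by
  obtain ⟨i, -, hi⟩ := Set.infinite_univ.exists_notMem_finite hf
  exact ⟨i, Function.notMem_mulSupport.mp hi⟩

/-- Conjugation by any sequence preserves finite supports. [folklore] -/
private theorem mulSupport_conj_finite (c : ℕ → S) {f : ℕ → S}
    (hf : (Function.mulSupport f).Finite) : (Function.mulSupport (c * f * c⁻¹)).Finite := by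
  refine hf.subset fun i hi => ?_
  rw [Function.mem_mulSupport] at hi ⊢
  exact fun h => hi (by simp [h])

/-- The finitely supported sequences with values in a countable group form a countable set (they are
the extensions by `1` of finite tuples). [folklore] -/
private theorem countable_setOf_mulSupport_finite [Countable S] :
    Countable {f : ℕ → S | (Function.mulSupport f).Finite} := by
  classical
  -- the extensions by `1` of finite tuples exhaust the finitely supported sequences
  let g : (Σ n : ℕ, (Fin n → S)) → {f : ℕ → S | (Function.mulSupport f).Finite} := fun q =>
    ⟨fun i => if h : i < q.1 then q.2 ⟨i, h⟩ else 1,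
      (Set.finite_lt_nat q.1).subset fun i hi => by_contra fun h => hi (dif_neg (show ¬ i < q.1 from h))⟩
  refine (show Function.Surjective g from fun ⟨f, hf⟩ => ?_).countable
  obtain ⟨n, hn⟩ := (show (Function.mulSupport f).Finite from hf).bddAbove
  refine ⟨⟨n + 1, fun i => f (i : ℕ)⟩, Subtype.ext (funext fun i => ?_)⟩
  show (if h : i < n + 1 then f ((⟨i, h⟩ : Fin (n + 1)) : ℕ) else 1 : S) = f i
  by_cases h : i < n + 1
  · rw [dif_pos h]
  · rw [dif_neg h]
    exact (by_contra fun hne => h (Nat.lt_succ_of_le (hn (Ne.symm hne))) : (1 : S) = f i)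

/-- `e_i(s)`, the sequence supported at `i`, is finitely supported. [folklore] -/
private theorem mulSupport_mulSingle_finite (i : ℕ) (s : S) :
    (Function.mulSupport (Pi.mulSingle i s : ℕ → S)).Finite :=
  (Set.finite_singleton i).subset Pi.mulSupport_mulSingle_subset

variable (D : Subgroup (ℕ → S)) (hD : ∀ f : ℕ → S, f ∈ D ↔ (Function.mulSupport f).Finite)

/-- A sequence supported in a finset `T` and in `W` at every single coordinate outside `F`, and equal to
`1` on `F`, lies in the subgroup `W`: induction on `T`, peeling off one coordinate at a time. [folklore] -/
private theorem mem_of_forall_mulSingle_mem (W : Subgroup (ℕ → S)) (F : Set ℕ)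
    (hW : ∀ i ∉ F, ∀ s : S, Pi.mulSingle i s ∈ W) :
    ∀ (T : Finset ℕ) (f : ℕ → S), Function.mulSupport f ⊆ T → (∀ i ∈ F, f i = 1) → f ∈ W := by
  classical
  intro T
  induction T using Finset.induction_on with
  | empty =>
    intro f hT _
    have hf : f = 1 := Function.mulSupport_eq_empty_iff.mp (Set.subset_empty_iff.mp (by simpa using hT))
    exact hf ▸ W.one_mem
  | insert j T hj ih =>
    intro f hT hF
    -- peel off the `j`-th coordinate
    have hsingle : Pi.mulSingle j (f j) ∈ W := by
      by_cases hjF : j ∈ F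
      · exact (hF j hjF).symm ▸ (Pi.mulSingle_one j (M := fun _ => S)).symm ▸ W.one_mem
      · exact hW j hjF (f j)
    have hrest : f * (Pi.mulSingle j (f j))⁻¹ ∈ W := by
      refine ih _ (fun i hi => ?_) (fun i hi => ?_)
      · rw [Function.mem_mulSupport] at hi
        have hij : i ≠ j := by rintro rfl; simp at hi
        refine Finset.mem_of_mem_insert_of_ne (hT ?_) hij
        rw [Function.mem_mulSupport]
        exact fun h1 => hi (by simp [h1, hij])
      · by_cases hij : i = j
        · subst hij; simp
        · simp [hF i hi, hij]
    exact (inv_mul_cancel_right f (Pi.mulSingle j (f j))) ▸ W.mul_mem hrest hsingle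

include hD in
/-- **Finite-index normal subgroups of `⊕_ℕ S`, `S` simple non-abelian, are cylinders**: for
`U ⊴ ⊕_ℕ S` of finite index there is a finite set `F` of indices such that every single-coordinate
sequence `e_i(s)`, `i ∉ F`, lies in `U`.  (The trace of `U` on the `i`-th factor is normal in `S`, hence
trivial or `S`; the indices of trivial trace inject into `(⊕_ℕ S)/U` by `i ↦ [e_i(a)]`, `a` non-central.)
[folklore] -/
private theorem exists_finite_forall_mulSingle_mem [IsSimpleGroup S] (a g : S) (hag : g * a * g⁻¹ ≠ a)
    (U : Subgroup D) [U.Normal] [U.FiniteIndex] :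
    ∃ F : Set ℕ, F.Finite ∧ ∀ i ∉ F, ∀ s : S,
      (⟨Pi.mulSingle i s, (hD _).2 (mulSupport_mulSingle_finite i s)⟩ : D) ∈ U := by
  classical
  -- the `i`-th factor embedding `e_i : S → ⊕_ℕ S`
  let e : ℕ → S →* D := fun i =>
    { toFun := fun s => ⟨Pi.mulSingle i s, (hD _).2 (mulSupport_mulSingle_finite i s)⟩
      map_one' := Subtype.ext (Pi.mulSingle_one i), map_mul' := fun s t =>
        Subtype.ext (Pi.mulSingle_mul (f := fun _ : ℕ => S) i s t) }
  -- the trace of `U` on the `i`-th factor is normal, hence `⊥` or `⊤`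
  have htrace : ∀ i, U.comap (e i) = ⊥ ∨ U.comap (e i) = ⊤ := fun i =>
    (inferInstance : (U.comap (e i)).Normal).eq_bot_or_eq_top
  let F : Set ℕ := {i | U.comap (e i) = ⊥}
  refine ⟨F, ?_, fun i hi s => ?_⟩
  · -- `i ↦ [e_i(a)] ∈ D ⧸ U` is injective on `F`
    haveI : Finite (D ⧸ U) := Subgroup.finite_quotient_of_finiteIndex
    refine Set.Finite.of_finite_image (f := fun i => (QuotientGroup.mk (e i a) : D ⧸ U))
      (Set.toFinite _) ?_
    intro i hi j hj hij
    by_contra hne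
    have hiF : U.comap (e i) = ⊥ := hi
    -- `e_i(a)⁻¹ e_j(a) ∈ U`; conjugating by `e_i(g)` and multiplying, `e_i(a⁻¹ g a g⁻¹) ∈ U`
    have h1 : (e i a)⁻¹ * e j a ∈ U := QuotientGroup.eq.mp hij
    have h2 : e i g * ((e i a)⁻¹ * e j a) * (e i g)⁻¹ ∈ U := ‹U.Normal›.conj_mem _ h1 _
    have hcomm : Commute (e i g) (e j a) := by
      rw [commute_iff_eq]
      exact Subtype.ext (Pi.mulSingle_commute (f := fun _ : ℕ => S) hne g a).eq
    have h3 : e i g * ((e i a)⁻¹ * e j a) * (e i g)⁻¹ = (e i (g * a * g⁻¹))⁻¹ * e j a := by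
      simp only [map_mul, map_inv]
      calc e i g * ((e i a)⁻¹ * e j a) * (e i g)⁻¹
          = e i g * (e i a)⁻¹ * (e j a * (e i g)⁻¹) := by group
        _ = e i g * (e i a)⁻¹ * ((e i g)⁻¹ * e j a) := by rw [hcomm.inv_left.eq]
        _ = (e i g * e i a * (e i g)⁻¹)⁻¹ * e j a := by group
    rw [h3] at h2
    have h4 : (e i a)⁻¹ * e j a * ((e i (g * a * g⁻¹))⁻¹ * e j a)⁻¹ ∈ U := U.mul_mem h1 (U.inv_mem h2)
    have h5 : (e i a)⁻¹ * e j a * ((e i (g * a * g⁻¹))⁻¹ * e j a)⁻¹ = e i (a⁻¹ * (g * a * g⁻¹)) := by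
      simp only [map_mul, map_inv]
      group
    rw [h5] at h4
    have h6 : a⁻¹ * (g * a * g⁻¹) ∈ U.comap (e i) := h4
    rw [hiF, Subgroup.mem_bot] at h6
    apply hag
    calc g * a * g⁻¹ = a * (a⁻¹ * (g * a * g⁻¹)) := by group
      _ = a := by rw [h6, mul_one]
  · -- outside `F` the trace is everything
    exact (show s ∈ U.comap (e i) by rw [(htrace i).resolve_left hi]; trivial)

end RestrictedProduct

/-! ### The tempered restricted-product datum and the failure of T64-L07 -/

section Curve

variable (p : ℕ) [Fact p.Prime]

/-- The construction, for any finite simple group `S` with a non-central element `a` (moved by `g`):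
the datum `Π^temp := (⊕_ℕ S) × G_{ℚ_p}` (discrete first factor) `↪ Π := (∏_ℕ S) × G_{ℚ_p}` is tempered,
has normal image, and violates T64-L07 and T64-L06′. [cite: MochizukiSemiAnbd2006, Thm 6.4 proof p.71] -/
private theorem exists_temperedCurve_isTempered_not_outerDescent_of {S : Type} [Group S] [Finite S]
    [IsSimpleGroup S] (a g : S) (hag : g * a * g⁻¹ ≠ a) :
    ∃ Y : TemperedCurve p, IsTempered Y.PiTemp ∧ Y.toHat.toMonoidHom.range.Normal ∧
      ¬ Y.OpenDenseDOFConjugator ∧ ¬ TemperedCurve.OuterDescent Y Y := by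
  classical
  letI : TopologicalSpace S := ⊥
  haveI : DiscreteTopology S := ⟨rfl⟩
  haveI : IsTopologicalGroup S :=
    { continuous_mul := continuous_of_discreteTopology, continuous_inv := continuous_of_discreteTopology }
  haveI : IsGalois ℚ_[p] (AlgebraicClosure ℚ_[p]) := {}
  haveI : T2Space (GQp p) := krullTopology_t2
  -- `D = ⊕_ℕ S`, DISCRETE
  let D : Subgroup (ℕ → S) :=
    { carrier := {f | (Function.mulSupport f).Finite}
      mul_mem' := fun {f g} hf hg => (hf.union hg).subset (Function.mulSupport_mul f g)
      one_mem' := by simp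
      inv_mem' := fun {f} hf => show (Function.mulSupport f⁻¹).Finite by rwa [Function.mulSupport_inv] }
  have hD : ∀ f : ℕ → S, f ∈ D ↔ (Function.mulSupport f).Finite := fun _ => Iff.rfl
  letI tD : TopologicalSpace D := ⊥
  haveI : DiscreteTopology D := ⟨rfl⟩
  haveI : IsTopologicalGroup D :=
    { continuous_mul := continuous_of_discreteTopology, continuous_inv := continuous_of_discreteTopology }
  haveI : Countable D := countable_setOf_mulSupport_finite
  have hDT : IsTempered D := isTempered_of_discreteTopology
  let ιD : D →ₜ* (ℕ → S) := { D.subtype with continuous_toFun := continuous_of_discreteTopology }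
  -- `⊕_ℕ S ↪ ∏_ℕ S` is the profinite completion of the discrete group `⊕_ℕ S`
  have hιD : IsProfiniteCompletion ιD := by
    refine ⟨inferInstance, inferInstance, inferInstance, ?_, ?_, fun V => isOpen_discrete _⟩
    · -- dense range (`range ιD = ⊕_ℕ S`)
      have hr : Set.range ιD = {f : ℕ → S | (Function.mulSupport f).Finite} :=
        Set.ext fun f => ⟨fun ⟨x, hx⟩ => hx ▸ x.2, fun hf => ⟨(⟨f, hf⟩ : D), rfl⟩⟩
      rw [DenseRange, hr]
      exact dense_setOf_mulSupport_finite
    · -- finite-index (open) normal subgroups are cylinders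
      intro U hU
      haveI : U.toSubgroup.Normal := U.isNormal'
      haveI := hU
      obtain ⟨F, hFfin, hF⟩ := exists_finite_forall_mulSingle_mem D hD a g hag U.toSubgroup
      -- `W = U` viewed in `∏_ℕ S`
      let W : Subgroup (ℕ → S) := U.toSubgroup.map D.subtype
      have hWD : ∀ {f : ℕ → S} (hf : f ∈ D), f ∈ W ↔ (⟨f, hf⟩ : D) ∈ U.toSubgroup := fun hf =>
        ⟨fun ⟨x, hx, hxf⟩ => by rwa [show x = ⟨_, hf⟩ from Subtype.ext hxf] at hx,
          fun h => ⟨⟨_, hf⟩, h, rfl⟩⟩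
      have hWsingle : ∀ i ∉ F, ∀ s : S, Pi.mulSingle i s ∈ W := fun i hi s =>
        (hWD _).2 (hF i hi s)
      -- sequences in `D` vanishing on `F` lie in `W`
      have hvanish : ∀ f ∈ D, (∀ i ∈ F, f i = 1) → f ∈ W := fun f hf hfF =>
        mem_of_forall_mulSingle_mem W F hWsingle ((hD f).1 hf).toFinset f (by simp) hfF
      -- `W` is normalised by `D`
      have hWconj : ∀ d ∈ D, ∀ w ∈ W, d * w * d⁻¹ ∈ W := by
        intro d hd w hw
        obtain ⟨x, hx, rfl⟩ := hw
        exact ⟨⟨d, hd⟩ * x * ⟨d, hd⟩⁻¹, ‹U.toSubgroup.Normal›.conj_mem x hx ⟨d, hd⟩, rfl⟩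
      -- the cylinder `V` over `W` along `F`
      let V : OpenNormalSubgroup (ℕ → S) :=
        { carrier := {x | ∃ w ∈ W, ∀ i ∈ F, x i = w i}
          mul_mem' := by
            rintro x y ⟨w, hw, hxw⟩ ⟨w', hw', hyw'⟩
            exact ⟨w * w', W.mul_mem hw hw', fun i hi => by
              rw [Pi.mul_apply, Pi.mul_apply, hxw i hi, hyw' i hi]⟩
          one_mem' := ⟨1, W.one_mem, fun i _ => rfl⟩
          inv_mem' := by
            rintro x ⟨w, hw, hxw⟩
            exact ⟨w⁻¹, W.inv_mem hw, fun i hi => by rw [Pi.inv_apply, Pi.inv_apply, hxw i hi]⟩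
          isOpen' := by
            have : {x : ℕ → S | ∃ w ∈ W, ∀ i ∈ F, x i = w i} =
                ⋃ w ∈ (W : Set (ℕ → S)), ⋂ i ∈ hFfin.toFinset, (fun x : ℕ → S => x i) ⁻¹' {w i} := by
              ext x
              simp only [Set.mem_setOf_eq, Set.mem_iUnion, Set.mem_iInter, Set.mem_preimage,
                Set.mem_singleton_iff, Set.Finite.mem_toFinset, SetLike.mem_coe, exists_prop]
            rw [this]
            refine isOpen_biUnion fun w _ => isOpen_biInter_finset fun i _ => ?_
            exact (continuous_apply i).isOpen_preimage _ (isOpen_discrete _)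
          isNormal' := by
            refine ⟨?_⟩
            rintro x ⟨w, hw, hxw⟩ c
            -- truncate the conjugator to `F`
            let cF : ℕ → S := fun i => if i ∈ F then c i else 1
            have hcF : cF ∈ D := (hD _).2 (hFfin.subset fun i hi => by
              by_contra h
              exact hi (by simp [cF, h]))
            refine ⟨cF * w * cF⁻¹, hWconj cF hcF w hw, fun i hi => ?_⟩
            simp [cF, hi, hxw i hi] }
      refine ⟨V, Subgroup.ext fun x => ?_⟩
      constructor
      · intro hx
        exact ⟨x.1, (hWD x.2).2 hx, fun i _ => rfl⟩
      · rintro ⟨w, hw, hxw⟩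
        replace hxw : ∀ i ∈ F, (x : ℕ → S) i = w i := hxw
        -- `w⁻¹ x` is finitely supported and vanishes on `F`
        have hwD : w ∈ D := Subgroup.map_subtype_le _ hw
        have h1 : w⁻¹ * (x : ℕ → S) ∈ W :=
          hvanish _ (D.mul_mem (D.inv_mem hwD) x.2) fun i hi => by
            rw [Pi.mul_apply, Pi.inv_apply, hxw i hi, inv_mul_cancel]
        exact (hWD x.2).1 ((mul_inv_cancel_left w (x : ℕ → S)) ▸ W.mul_mem hw h1)
  -- the datum
  let Y : TemperedCurve p :=
    { K := ⊥
      finiteDimensional_K := inferInstance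
      PiTemp := D × GQp p
      aug := ContinuousMonoidHom.snd D (GQp p)
      range_aug := by
        rw [IntermediateField.fixingSubgroup_bot]
        exact MonoidHom.range_eq_top.mpr Prod.snd_surjective
      PiHat := (ℕ → S) × GQp p
      toHat := ιD.prodMap (ContinuousMonoidHom.id (GQp p))
      isProfiniteCompletion_toHat := hιD.prodMap_id
      toHat_injective := Subtype.val_injective.prodMap Function.injective_id
      augHat := ContinuousMonoidHom.snd _ (GQp p)
      augHat_comp := fun _ => rfl
      Pt := PEmpty, IsCusp := fun x => x.elim, decomp := fun x => x.elim
      isClosed_decomp := fun x => x.elim, isOpen_aug_decomp := fun x => x.elim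
      inertia_eq_bot := fun x => x.elim, inertia_equiv_zHat := fun x => x.elim }
  have hYT : IsTempered Y.PiTemp := hDT.prod_of_profinite
  -- the conjugator: the constant sequence at `g`
  let c : ℕ → S := fun _ => g
  let φD : D →ₜ* D :=
    { toFun := fun f => ⟨c * f.1 * c⁻¹, mulSupport_conj_finite c f.2⟩
      map_one' := by ext1; simp
      map_mul' := fun f f' => by
        ext1
        simp only [Subgroup.coe_mul]
        group
      continuous_toFun := continuous_of_discreteTopology }
  have hφD_apply : ∀ f : D, ((φD f : D) : ℕ → S) = c * f.1 * c⁻¹ := fun _ => rfl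
  let φ : Y.PiTemp →ₜ* Y.PiTemp := φD.prodMap (ContinuousMonoidHom.id (GQp p))
  have hφ_apply : ∀ x : D × GQp p, φ x = (φD x.1, x.2) := fun _ => rfl
  have hφsurj : Function.Surjective φ := by
    rintro ⟨f, γ⟩
    refine ⟨(⟨c⁻¹ * f.1 * c⁻¹⁻¹, mulSupport_conj_finite c⁻¹ f.2⟩, γ), ?_⟩
    rw [hφ_apply]
    refine Prod.ext (Subtype.ext ?_) rfl
    rw [hφD_apply]
    simp only [inv_inv]
    group
  -- the image of `Π^temp` is normal in `Π`
  have hnormal : Y.toHat.toMonoidHom.range.Normal := by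
    refine ⟨?_⟩
    rintro _ ⟨⟨f, γ⟩, rfl⟩ ⟨u, b⟩
    exact ⟨(⟨u * f.1 * u⁻¹, mulSupport_conj_finite u f.2⟩, b * γ * b⁻¹), rfl⟩
  -- T64-L07 fails
  have hOD : ¬ TemperedCurve.OuterDescent Y Y := by
    intro h
    obtain ⟨⟨d, γ⟩, hy⟩ := h φ (ContinuousMonoidHom.id _) (isDOFTypeHom_of_surjective φ hφsurj)
      isDOFTypeHom_id ⟨((c, (1 : GQp p)) : (ℕ → S) × GQp p), fun x => by
        show ((c * x.1.1 * c⁻¹, x.2) : (ℕ → S) × GQp p) = (c, 1) * (x.1.1, x.2) * (c, 1)⁻¹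
        rw [Prod.inv_mk, Prod.mk_mul_mk, Prod.mk_mul_mk, inv_one, mul_one, one_mul]⟩
    obtain ⟨i, hi⟩ := exists_apply_eq_one_of_mulSupport_finite d.2
    have hxmem : (Pi.mulSingle i a : ℕ → S) ∈ D := (hD _).2 (mulSupport_mulSingle_finite i a)
    let x : D × GQp p := (⟨Pi.mulSingle i a, hxmem⟩, 1)
    have h1 := congrArg (fun z : D × GQp p => ((z.1 : D) : ℕ → S) i) (hy x)
    have h2 : (c * (Pi.mulSingle i a : ℕ → S) * c⁻¹ : ℕ → S) i =
        ((d : ℕ → S) * (Pi.mulSingle i a : ℕ → S) * (d : ℕ → S)⁻¹ : ℕ → S) i := h1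
    simp only [c, Pi.mul_apply, Pi.inv_apply, Pi.mulSingle_eq_same, hi, one_mul, inv_one, mul_one] at h2
    exact hag h2
  exact ⟨Y, hYT, hnormal, fun h => hOD (Y.outerDescent_of_openDenseDOFConjugator Y h), hOD⟩

/-- **A TEMPERED datum of the §6 interface at which T64-L07 `OuterDescent` FAILS.**  There is
`Y : TemperedCurve p` (`K = ℚ_p`, `Π^temp := (⊕_ℕ A₅) × G_{ℚ_p}` with `⊕_ℕ A₅` discrete,
`Π := (∏_ℕ A₅) × G_{ℚ_p}`, no closed points) with `Π^temp` TEMPERED ([SemiAnbd] Def. 3.1 (i)), whose image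
in `Π` is normal, and a continuous onto endomorphism of `Π^temp` that is `Π`-conjugate but not
`Π^temp`-conjugate to the identity: `¬ OuterDescent Y Y` (hence, by the tree's T64-L07 ⇐ T64-L06′,
`¬ Y.OpenDenseDOFConjugator`). [cite: MochizukiSemiAnbd2006, Thm 6.4 proof p.71] -/
theorem exists_temperedCurve_isTempered_not_outerDescent :
    ∃ Y : TemperedCurve p, IsTempered Y.PiTemp ∧ Y.toHat.toMonoidHom.range.Normal ∧
      ¬ Y.OpenDenseDOFConjugator ∧ ¬ TemperedCurve.OuterDescent Y Y := by
  haveI : IsSimpleGroup (alternatingGroup (Fin 5)) := alternatingGroup.isSimpleGroup (by simp)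
  -- two non-commuting even permutations of `Fin 5`
  refine exists_temperedCurve_isTempered_not_outerDescent_of p (S := ↥(alternatingGroup (Fin 5)))
    ⟨Equiv.swap 0 1 * Equiv.swap 1 2, Equiv.Perm.mem_alternatingGroup.mpr (by decide)⟩
    ⟨Equiv.swap 0 1 * Equiv.swap 1 3, Equiv.Perm.mem_alternatingGroup.mpr (by decide)⟩ (by decide)

/-- **F-2838 is tower-guarded by necessity among TEMPERED data**: the closed form
`∀ X Y, IsTempered Y.PiTemp → OuterDescent X Y` is FALSE over the §6 interface — the André-tower binder
`htower₀` of `TemperedCurve.temperedAnabelianTheorem_of_tower` cannot be weakened to temperedness for the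
concluding inference T64-L07 of [SemiAnbd] Thm. 6.4. [cite: MochizukiSemiAnbd2006, Thm 6.4 proof p.71] -/
theorem not_forall_isTempered_outerDescent :
    ¬ ∀ X Y : TemperedCurve p, IsTempered Y.PiTemp → TemperedCurve.OuterDescent X Y := fun h => by
  obtain ⟨Y, hT, -, -, hY⟩ := exists_temperedCurve_isTempered_not_outerDescent p
  exact hY (h Y Y hT)

/-- Likewise for T64-L06′ (F-2837) and Lemma 6.1 (iii) at this second tempered datum (the first being
`ℤ × G_{ℚ_p}` of `TemperedAnabelianTowerNecessity`): temperedness does not imply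
`OpenDenseDOFConjugator`. [cite: MochizukiSemiAnbd2006, Lem 6.3(iii) p.70] -/
theorem not_forall_isTempered_openDenseDOFConjugator :
    ¬ ∀ Y : TemperedCurve p, IsTempered Y.PiTemp → Y.OpenDenseDOFConjugator := fun h => by
  obtain ⟨Y, hT, -, hY, -⟩ := exists_temperedCurve_isTempered_not_outerDescent p
  exact hY (h Y hT)

end Curve

end Literature.AnabelianGeometry.SemiGraphs

end
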